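import Summits.QuantumFields.QCD.Theses.PauliWegnerSea
import Literature.MathematicalPhysics.QuantumFieldTheory.QCDPhaseQuenched

/-!
# Crux `GluonicCompletion` (stmt-QuantumFields-9152), line `finite-sign-budget-at-the-scheme-volume` — stub `stub_detAlongLinkCurve`

The Wilson determinant along a one-link circle is a trigonometric polynomial: if the link curve
`c : ℝ → SU(3)` has entries of the form `p(e^{iθ}) e^{-iNθ}` (`p ∈ ℂ[X]`, `N ∈ ℕ`), then so has
`θ ↦ det D(U · δ_e(c(θ)) · V)` for all configurations `U, V`, all quark masses and every edge `e`
(`δ_e = Pi.mulSingle e`).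

Proof.  The class `T = {θ ↦ p(e^{iθ}) e^{-iNθ}}` of trigonometric polynomials (written inline in every
statement below) contains the constants and is closed under sums, products, finite sums and products,
`if-then-else` with a `θ`-independent condition, and complex conjugation
(`conj (p(e^{iθ}) e^{-iNθ}) = q(e^{iθ}) e^{-i d θ}` with `d = deg p`, `q = ∑ₖ conj(aₖ) X^{N+d-k}`).  By the
Leibniz expansion (`Matrix.det_apply'`) the determinant of a matrix with entries in `T` is in `T`.  By
`det_diracMatrix` the `N_f`-flavour determinant is the product of the one-flavour Wilson determinants, and
every entry of `D_W(U δ_e(c θ) V, m, 1)` (tree `wilsonDirac`, `fundamentalRep` = inclusion) is a constant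
plus constants times entries of the links `U_{e'} (δ_e(c θ))_{e'} V_{e'}` — sums of constants times entries
of `c θ` (or constants, for `e' ≠ e`) — and of their inverses, which in `SU(3)` are the conjugate
transposes.
-/

noncomputable section

namespace Summit.QuantumFields.QCD.Theorems.FiniteSignBudgetAtTheSchemeVolume

open scoped BigOperators
open MeasureTheory Filter
open Literature.MathematicalPhysics.QuantumFieldTheory Literature.MathematicalPhysics.QuantumLattice
  Literature.Probability.LatticeModels

/-- `(e^{iθ})^N · e^{-iNθ} = 1`. [folklore] -/
private theorem exp_pow_mul_exp_neg (θ : ℝ) (N : ℕ) :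
    Complex.exp (θ * Complex.I) ^ N * Complex.exp (-(N * θ * Complex.I)) = 1 := by
  rw [← Complex.exp_nat_mul, ← Complex.exp_add]
  convert Complex.exp_zero using 2
  ring

/-- `e^{-i(N₁+N₂)θ} = e^{-iN₁θ} e^{-iN₂θ}`. [folklore] -/
private theorem exp_neg_add_mul (θ : ℝ) (N₁ N₂ : ℕ) :
    Complex.exp (-((N₁ + N₂ : ℕ) * θ * Complex.I)) =
      Complex.exp (-(N₁ * θ * Complex.I)) * Complex.exp (-(N₂ * θ * Complex.I)) := by
  rw [← Complex.exp_add]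
  congr 1
  push_cast
  ring

/-- Constants are trigonometric polynomials (`N = 0`, `p = C a`). [folklore] -/
private theorem trigPoly_const (a : ℂ) :
    ∃ (N : ℕ) (p : Polynomial ℂ), ∀ θ : ℝ,
      a = p.eval (Complex.exp (θ * Complex.I)) * Complex.exp (-(N * θ * Complex.I)) :=
  ⟨0, Polynomial.C a, fun θ => by simp⟩

/-- Trigonometric polynomials are closed under addition
(`p₁ e^{-iN₁θ} + p₂ e^{-iN₂θ} = (p₁ X^{N₂} + p₂ X^{N₁}) e^{-i(N₁+N₂)θ}`). [folklore] -/
private theorem trigPoly_add {f g : ℝ → ℂ}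
    (hf : ∃ (N : ℕ) (p : Polynomial ℂ), ∀ θ : ℝ,
      f θ = p.eval (Complex.exp (θ * Complex.I)) * Complex.exp (-(N * θ * Complex.I)))
    (hg : ∃ (N : ℕ) (p : Polynomial ℂ), ∀ θ : ℝ,
      g θ = p.eval (Complex.exp (θ * Complex.I)) * Complex.exp (-(N * θ * Complex.I))) :
    ∃ (N : ℕ) (p : Polynomial ℂ), ∀ θ : ℝ,
      f θ + g θ = p.eval (Complex.exp (θ * Complex.I)) * Complex.exp (-(N * θ * Complex.I)) := by
  obtain ⟨N₁, p₁, hf⟩ := hf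
  obtain ⟨N₂, p₂, hg⟩ := hg
  refine ⟨N₁ + N₂, p₁ * Polynomial.X ^ N₂ + p₂ * Polynomial.X ^ N₁, fun θ => ?_⟩
  rw [hf, hg, Polynomial.eval_add, Polynomial.eval_mul, Polynomial.eval_mul, Polynomial.eval_pow,
    Polynomial.eval_pow, Polynomial.eval_X, exp_neg_add_mul]
  linear_combination
    (-(p₁.eval (Complex.exp (θ * Complex.I)) * Complex.exp (-(N₁ * θ * Complex.I)))) *
        exp_pow_mul_exp_neg θ N₂ +
      (-(p₂.eval (Complex.exp (θ * Complex.I)) * Complex.exp (-(N₂ * θ * Complex.I)))) *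
        exp_pow_mul_exp_neg θ N₁

/-- Trigonometric polynomials are closed under multiplication
(`p₁ e^{-iN₁θ} · p₂ e^{-iN₂θ} = (p₁ p₂) e^{-i(N₁+N₂)θ}`). [folklore] -/
private theorem trigPoly_mul {f g : ℝ → ℂ}
    (hf : ∃ (N : ℕ) (p : Polynomial ℂ), ∀ θ : ℝ,
      f θ = p.eval (Complex.exp (θ * Complex.I)) * Complex.exp (-(N * θ * Complex.I)))
    (hg : ∃ (N : ℕ) (p : Polynomial ℂ), ∀ θ : ℝ,
      g θ = p.eval (Complex.exp (θ * Complex.I)) * Complex.exp (-(N * θ * Complex.I))) :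
    ∃ (N : ℕ) (p : Polynomial ℂ), ∀ θ : ℝ,
      f θ * g θ = p.eval (Complex.exp (θ * Complex.I)) * Complex.exp (-(N * θ * Complex.I)) := by
  obtain ⟨N₁, p₁, hf⟩ := hf
  obtain ⟨N₂, p₂, hg⟩ := hg
  refine ⟨N₁ + N₂, p₁ * p₂, fun θ => ?_⟩
  rw [hf, hg, Polynomial.eval_mul, exp_neg_add_mul]
  ring

/-- Trigonometric polynomials are closed under subtraction. [folklore] -/
private theorem trigPoly_sub {f g : ℝ → ℂ}
    (hf : ∃ (N : ℕ) (p : Polynomial ℂ), ∀ θ : ℝ,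
      f θ = p.eval (Complex.exp (θ * Complex.I)) * Complex.exp (-(N * θ * Complex.I)))
    (hg : ∃ (N : ℕ) (p : Polynomial ℂ), ∀ θ : ℝ,
      g θ = p.eval (Complex.exp (θ * Complex.I)) * Complex.exp (-(N * θ * Complex.I))) :
    ∃ (N : ℕ) (p : Polynomial ℂ), ∀ θ : ℝ,
      f θ - g θ = p.eval (Complex.exp (θ * Complex.I)) * Complex.exp (-(N * θ * Complex.I)) := by
  obtain ⟨N, p, h⟩ := trigPoly_add hf (trigPoly_mul (trigPoly_const (-1)) hg)
  refine ⟨N, p, fun θ => ?_⟩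
  have hθ := h θ
  rwa [neg_one_mul, ← sub_eq_add_neg] at hθ

/-- Trigonometric polynomials are closed under `if P then · else ·` for a `θ`-independent `P`. [folklore] -/
private theorem trigPoly_ite (P : Prop) [Decidable P] {f g : ℝ → ℂ}
    (hf : ∃ (N : ℕ) (p : Polynomial ℂ), ∀ θ : ℝ,
      f θ = p.eval (Complex.exp (θ * Complex.I)) * Complex.exp (-(N * θ * Complex.I)))
    (hg : ∃ (N : ℕ) (p : Polynomial ℂ), ∀ θ : ℝ,
      g θ = p.eval (Complex.exp (θ * Complex.I)) * Complex.exp (-(N * θ * Complex.I))) :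
    ∃ (N : ℕ) (p : Polynomial ℂ), ∀ θ : ℝ,
      (if P then f θ else g θ) =
        p.eval (Complex.exp (θ * Complex.I)) * Complex.exp (-(N * θ * Complex.I)) := by
  by_cases h : P
  · simp only [h, ↓reduceIte]
    exact hf
  · simp only [h, ↓reduceIte]
    exact hg

/-- Trigonometric polynomials are closed under finite sums. [folklore] -/
private theorem trigPoly_sum {ι : Type*} (s : Finset ι) (f : ι → ℝ → ℂ)
    (hf : ∀ i ∈ s, ∃ (N : ℕ) (p : Polynomial ℂ), ∀ θ : ℝ,
      f i θ = p.eval (Complex.exp (θ * Complex.I)) * Complex.exp (-(N * θ * Complex.I))) :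
    ∃ (N : ℕ) (p : Polynomial ℂ), ∀ θ : ℝ,
      ∑ i ∈ s, f i θ = p.eval (Complex.exp (θ * Complex.I)) * Complex.exp (-(N * θ * Complex.I)) := by
  classical
  induction s using Finset.induction_on with
  | empty => exact ⟨0, 0, fun θ => by simp⟩
  | @insert a s ha ih =>
    obtain ⟨N, p, h⟩ := trigPoly_add (hf a (Finset.mem_insert_self a s))
      (ih fun i hi => hf i (Finset.mem_insert_of_mem hi))
    exact ⟨N, p, fun θ => by rw [Finset.sum_insert ha]; exact h θ⟩

/-- Trigonometric polynomials are closed under finite products. [folklore] -/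
private theorem trigPoly_prod {ι : Type*} (s : Finset ι) (f : ι → ℝ → ℂ)
    (hf : ∀ i ∈ s, ∃ (N : ℕ) (p : Polynomial ℂ), ∀ θ : ℝ,
      f i θ = p.eval (Complex.exp (θ * Complex.I)) * Complex.exp (-(N * θ * Complex.I))) :
    ∃ (N : ℕ) (p : Polynomial ℂ), ∀ θ : ℝ,
      ∏ i ∈ s, f i θ = p.eval (Complex.exp (θ * Complex.I)) * Complex.exp (-(N * θ * Complex.I)) := by
  classical
  induction s using Finset.induction_on with
  | empty =>
    obtain ⟨N, p, h⟩ := trigPoly_const (1 : ℂ)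
    exact ⟨N, p, fun θ => by rw [Finset.prod_empty]; exact h θ⟩
  | @insert a s ha ih =>
    obtain ⟨N, p, h⟩ := trigPoly_mul (hf a (Finset.mem_insert_self a s))
      (ih fun i hi => hf i (Finset.mem_insert_of_mem hi))
    exact ⟨N, p, fun θ => by rw [Finset.prod_insert ha]; exact h θ⟩

/-- Trigonometric polynomials are closed under complex conjugation: if `f θ = p(e^{iθ}) e^{-iNθ}` and
`d = deg p`, `p = ∑_{k ≤ d} a_k X^k`, then `conj (f θ) = ∑_k conj(a_k) e^{-ikθ} e^{iNθ} = q(e^{iθ}) e^{-idθ}`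
with `q = ∑_{k ≤ d} conj(a_k) X^{N+d-k}`. [folklore] -/
private theorem trigPoly_star {f : ℝ → ℂ}
    (hf : ∃ (N : ℕ) (p : Polynomial ℂ), ∀ θ : ℝ,
      f θ = p.eval (Complex.exp (θ * Complex.I)) * Complex.exp (-(N * θ * Complex.I))) :
    ∃ (N : ℕ) (p : Polynomial ℂ), ∀ θ : ℝ,
      star (f θ) = p.eval (Complex.exp (θ * Complex.I)) * Complex.exp (-(N * θ * Complex.I)) := by
  obtain ⟨N, p, hf⟩ := hf
  refine ⟨p.natDegree, ∑ k ∈ Finset.range (p.natDegree + 1),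
    Polynomial.C (star (p.coeff k)) * Polynomial.X ^ (N + p.natDegree - k), fun θ => ?_⟩
  have hz : star (Complex.exp (θ * Complex.I)) = Complex.exp (-(θ * Complex.I)) := by
    rw [← starRingEnd_apply, ← Complex.exp_conj, map_mul, Complex.conj_ofReal, Complex.conj_I]
    congr 1
    ring
  have hE : star (Complex.exp (-(N * θ * Complex.I))) = Complex.exp (N * θ * Complex.I) := by
    rw [← starRingEnd_apply, ← Complex.exp_conj, map_neg, map_mul, map_mul, Complex.conj_ofReal,
      Complex.conj_I, map_natCast]
    congr 1
    ring
  rw [hf, Polynomial.eval_eq_sum_range (p := p), star_mul', star_sum, Polynomial.eval_finsetSum,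
    Finset.sum_mul, Finset.sum_mul]
  refine Finset.sum_congr rfl fun k hk => ?_
  have hk' : k ≤ N + p.natDegree := by
    have := Finset.mem_range_succ_iff.1 hk
    omega
  have key : Complex.exp (-(θ * Complex.I)) ^ k * Complex.exp (N * θ * Complex.I) =
      Complex.exp (θ * Complex.I) ^ (N + p.natDegree - k) *
        Complex.exp (-(p.natDegree * θ * Complex.I)) := by
    rw [← Complex.exp_nat_mul, ← Complex.exp_nat_mul, ← Complex.exp_add, ← Complex.exp_add]
    congr 1
    push_cast [Nat.cast_sub hk']
    ring
  rw [star_mul', star_pow, Polynomial.eval_mul, Polynomial.eval_C, Polynomial.eval_pow,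
    Polynomial.eval_X, hz, hE, mul_assoc, key, ← mul_assoc]

/-- The determinant of a matrix whose entries are trigonometric polynomials is a trigonometric
polynomial (Leibniz expansion `det M = ∑_σ sgn σ ∏_i M_{σ i, i}`). [folklore] -/
private theorem trigPoly_det {n : Type*} [Fintype n] [DecidableEq n] (M : ℝ → Matrix n n ℂ)
    (hM : ∀ i j, ∃ (N : ℕ) (p : Polynomial ℂ), ∀ θ : ℝ,
      M θ i j = p.eval (Complex.exp (θ * Complex.I)) * Complex.exp (-(N * θ * Complex.I))) :
    ∃ (N : ℕ) (p : Polynomial ℂ), ∀ θ : ℝ,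
      (M θ).det = p.eval (Complex.exp (θ * Complex.I)) * Complex.exp (-(N * θ * Complex.I)) := by
  simp_rw [Matrix.det_apply']
  exact trigPoly_sum _ _ fun σ _ =>
    trigPoly_mul (trigPoly_const _) (trigPoly_prod _ _ fun i _ => hM _ _)

/-- Entries of the modified link variables `(U · δ_e(c θ) · V)_{e'}` are trigonometric polynomials:
for `e' = e` the entry `(U_e c(θ) V_e)_{ab} = ∑_{j} (∑_{i} (U_e)_{ai} c(θ)_{ij}) (V_e)_{jb}` is a sum of
constants times entries of `c θ`, and for `e' ≠ e` the link `U_{e'} V_{e'}` is constant. [folklore] -/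
private theorem trigPoly_link {S : ℕ} (U V : GaugeConfig 4 S SU3) (e e' : Edge 4 S) (c : ℝ → SU3)
    (hc : ∀ a b : Fin 3, ∃ (N : ℕ) (p : Polynomial ℂ), ∀ θ : ℝ,
      (c θ : Matrix (Fin 3) (Fin 3) ℂ) a b =
        p.eval (Complex.exp (θ * Complex.I)) * Complex.exp (-(N * θ * Complex.I)))
    (a b : Fin 3) :
    ∃ (N : ℕ) (p : Polynomial ℂ), ∀ θ : ℝ,
      ((U * Pi.mulSingle e (c θ) * V : GaugeConfig 4 S SU3) e' : Matrix (Fin 3) (Fin 3) ℂ) a b =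
        p.eval (Complex.exp (θ * Complex.I)) * Complex.exp (-(N * θ * Complex.I)) := by
  by_cases he : e' = e
  · subst he
    simp_rw [Pi.mul_apply, Pi.mulSingle_eq_same, Submonoid.coe_mul, Matrix.mul_apply]
    exact trigPoly_sum _ _ fun j _ =>
      trigPoly_mul (trigPoly_sum _ _ fun i _ => trigPoly_mul (trigPoly_const _) (hc i j))
        (trigPoly_const _)
  · simp_rw [Pi.mul_apply, Pi.mulSingle_eq_of_ne he, mul_one]
    exact trigPoly_const _

/-- Entries of the inverses `((U · δ_e(c θ) · V)_{e'})⁻¹` of the modified link variables are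
trigonometric polynomials: in `SU(3)` the inverse is the conjugate transpose, and the class is closed
under conjugation. [folklore] -/
private theorem trigPoly_link_inv {S : ℕ} (U V : GaugeConfig 4 S SU3) (e e' : Edge 4 S) (c : ℝ → SU3)
    (hc : ∀ a b : Fin 3, ∃ (N : ℕ) (p : Polynomial ℂ), ∀ θ : ℝ,
      (c θ : Matrix (Fin 3) (Fin 3) ℂ) a b =
        p.eval (Complex.exp (θ * Complex.I)) * Complex.exp (-(N * θ * Complex.I)))
    (a b : Fin 3) :
    ∃ (N : ℕ) (p : Polynomial ℂ), ∀ θ : ℝ,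
      ((((U * Pi.mulSingle e (c θ) * V : GaugeConfig 4 S SU3) e')⁻¹ : SU3) : Matrix (Fin 3) (Fin 3) ℂ) a b =
        p.eval (Complex.exp (θ * Complex.I)) * Complex.exp (-(N * θ * Complex.I)) := by
  have h : ∀ θ : ℝ, ((((U * Pi.mulSingle e (c θ) * V : GaugeConfig 4 S SU3) e')⁻¹ : SU3) : Matrix (Fin 3) (Fin 3) ℂ) a b =
      star (((U * Pi.mulSingle e (c θ) * V : GaugeConfig 4 S SU3) e' : Matrix (Fin 3) (Fin 3) ℂ) b a) := fun θ => rfl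
  simp_rw [h]
  exact trigPoly_star (trigPoly_link U V e e' c hc b a)

/-- Entries of the one-flavour Wilson–Dirac matrix `D_W(U δ_e(c θ) V, m, r)` along the link curve are
trigonometric polynomials: by the tree definition `wilsonDirac` every entry is a constant minus
`½ ∑_μ` of `θ`-independent `if`'s of constants times entries of a link variable or of its inverse
(`fundamentalRep` is the inclusion). [folklore] -/
private theorem trigPoly_wilsonDirac_apply {S : ℕ} (U V : GaugeConfig 4 S SU3) (e : Edge 4 S)
    (c : ℝ → SU3)
    (hc : ∀ a b : Fin 3, ∃ (N : ℕ) (p : Polynomial ℂ), ∀ θ : ℝ,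
      (c θ : Matrix (Fin 3) (Fin 3) ℂ) a b =
        p.eval (Complex.exp (θ * Complex.I)) * Complex.exp (-(N * θ * Complex.I)))
    (m r : ℝ) (v w : TorusSite 4 S × Fin 3 × Fin 4) :
    ∃ (N : ℕ) (p : Polynomial ℂ), ∀ θ : ℝ,
      wilsonDirac (fundamentalRep (Fin 3)) (U * Pi.mulSingle e (c θ) * V) m r v w =
        p.eval (Complex.exp (θ * Complex.I)) * Complex.exp (-(N * θ * Complex.I)) := by
  simp only [wilsonDirac, Matrix.of_apply, fundamentalRep_apply]
  refine trigPoly_sub (trigPoly_const _) (trigPoly_mul (trigPoly_const _)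
    (trigPoly_sum _ _ fun μ _ => trigPoly_add
      (trigPoly_ite _ (trigPoly_mul (trigPoly_const _) ?_) (trigPoly_const _))
      (trigPoly_ite _ (trigPoly_mul (trigPoly_const _) ?_) (trigPoly_const _))))
  · exact trigPoly_link U V e _ c hc _ _
  · exact trigPoly_link_inv U V e _ c hc _ _

/-- **`stub_detAlongLinkCurve` — the Wilson determinant along a one-link circle is a trigonometric
polynomial.** If the link curve `c : ℝ → SU(3)` has entries of the form `p(e^{iθ}) e^{-iNθ}`
(`p ∈ ℂ[X]`), then so has `θ ↦ det D(U · δ_e(c(θ)) · V)` for all configurations `U, V` and every edge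
`e` (`δ_e` = `Pi.mulSingle e`).  Proof: `det D = ∏_f det D_W(·, m_f, 1)` (`det_diracMatrix`), each
`det D_W` is the Leibniz sum of products of entries (`trigPoly_det`), and the entries of `D_W` along the
curve are trigonometric polynomials (`trigPoly_wilsonDirac_apply`: constants plus constants times entries
of `U_{e'} c_{e'}(θ) V_{e'}` and of its inverse = conjugate transpose; the class is closed under `+`, `·`,
constants and complex conjugation). [folklore] -/
theorem stub_detAlongLinkCurve :
    ∀ (Nf S : ℕ) [NeZero S] (mq : Fin Nf → ℝ) (U V : GaugeConfig 4 S SU3) (e : Edge 4 S) (c : ℝ → SU3),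
      (∀ a b : Fin 3, ∃ (N : ℕ) (p : Polynomial ℂ), ∀ θ : ℝ,
        (c θ : Matrix (Fin 3) (Fin 3) ℂ) a b =
          p.eval (Complex.exp (θ * Complex.I)) * Complex.exp (-(N * θ * Complex.I))) →
      ∃ (N : ℕ) (p : Polynomial ℂ), ∀ θ : ℝ,
        (diracMatrix (U * Pi.mulSingle e (c θ) * V) mq).det =
          p.eval (Complex.exp (θ * Complex.I)) * Complex.exp (-(N * θ * Complex.I)) := by
  intro Nf S _ mq U V e c hc
  simp_rw [det_diracMatrix]
  exact trigPoly_prod _ _ fun f _ =>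
    trigPoly_det _ fun v w => trigPoly_wilsonDirac_apply U V e c hc (mq f) 1 v w

end Summit.QuantumFields.QCD.Theorems.FiniteSignBudgetAtTheSchemeVolume

end
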